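import Literature.MathematicalPhysics.QuantumFieldTheory.Balaban1983to89.Node00.Record13CarriersB8SubB
import Literature.MathematicalPhysics.QuantumFieldTheory.Balaban1983to89.B8LeafModelZd3SourceReality

/-!
# BalabanUVNodes ∕ N05 ([B8], `Dag.B8_main`) — THE `b8` LEAF IS FALSE AT EVERY STAGE-13 [B8″]-PINNED RECORD `Node00.IsRecordOfRecord₁₃CSB8subB` (every `F`,
# `N`, datum, world, package), hence `Dag.B8_main` there is EQUIVALENT TO THE FAILURE OF THE [4] LEAF `b9`: the record-level face of seat n05-c g5's
# carrier negative `B8LeafModelZd3SourceReality.not_b8LeafOfRecordSubB` (p501857) — what the N05 count line at the ⁗ record must NOT be read against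

Track A of `YM-PLAN.md` (cell `pub-ymgap`, HUMAN RULING D-0062), node **N05** = [Balaban1985RegularSpaces] Lemma 1, Thm 2, Prop 3, Thm 4, Props 5–7, Thm 8
(`Dag.B8_main ℓ := ℓ.b5 → ℓ.b6 → ℓ.b7 → ℓ.b9 → ℓ.b8`, `Dag.lean` :198); R134 seat `pub-ymgap-dag-n05-c` (g5), 2026-08-27.  A LOCATED NEGATIVE at the record,
count-neutral; nothing of print is refuted.

WHAT IS PROVED (composition BY NAME of landed theorems; no estimate; no definition):
* `two_le_D_of_admissible₁₃` — an admissible Stage-13 tuple has `2 ≤ D` (the first clause of `Node00.Stage1Params.Admissible`, read through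
  `Stage13 → Stage9 → Stage8 → Stage7 → Stage5 → Stage1`).
* ★ **`not_b8_of_isRecordOfRecord₁₃CSB8subB`**: `IsRecordOfRecord₁₃CSB8subB F N D w → ∀ P, ¬ (leavesP w P).b8` — by n05-d g4's
  `Node00.leaf_b8_iff_of_isRecordOfRecord₁₃CSB8subB` (`b8 ↔ B8LeafOfRecordSubB θ λ`) and `not_b8LeafOfRecordSubB` (the [B8″] slot of record is
  uninhabited for every residual layer `λ`: Theorem 8's surviving form is false at `zdGF3`'s record families because the typed source space `Src ∕ InR`
  forgets «Lie algebra valued» — p501857; and «finite norm» — `B8LeafModelZd3SourceBounded`, p503878).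
* ★ **`b8_main_iff_not_b9_of_isRecordOfRecord₁₃CSB8subB`**: at every such record and every package `P`, `Dag.B8_main (leavesP w P) ↔ ¬ (leavesP w P).b9`
  (the in-edges `b5 b6 b7` are theorems there, `Node00.b8_b11_b10_main_iff_of_isRecordOfRecord₁₃CSB8subB`) — N05 «holds» at such a record ONLY ex falso,
  through a failure of the [Balaban1985BackgroundPropagators] leaf.
* `not_exists_isRecordOfRecord₁₃CSB8subB_and_b8` — no world of this record predicate has `b8` at any package: every ∃-currency N05 face concluding
  `∃ w, IsRecordOfRecord₁₃CSB8subB … w ∧ … ∧ ∀ P, (leavesP w P).b8 ∧ …` (p491938 ∕ p495958 ∕ p501054) has jointly unsatisfiable hypotheses.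
READING FOR THE TABLE: the K1⁗ text (`StabilityBAtRecordR13Sep`) does not read `b8`; the N05 COUNT LINE at the [B8″]-pinned record does, and cannot be met
as typed — the cure is the re-pin on the repaired carrier `B8LeafModelZd3H.zdGF3H` (p504278; honest `t8` assembly `B8Thm8SurvivingZd3H`, p505395), owner
word pending (node00-def lineage ∕ `pub-ymgap-dag-n05-d`).
HONEST FRAMING: kernel bookkeeping by name; a typing negative about the tree's record, not about Bałaban's theorems; count-neutral (nothing was booked on
`b8`); **N05 NOT discharged**; Bałaban AS PRINTED (Thm 8 (1.146) p.101 «f … a Lie algebra valued function defined on Ω₀»); one finite 𝕋⁴ programme at fixed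
ε; nothing continuum ∕ ℝ⁴ ∕ OS ∕ mass-gap ∕ Clay.  No `sorry`, no definition.
[cite: Balaban1985RegularSpaces, Thm 8 (1.146) p.101, Lemma 1 – Thm 8 pp.79–101 (the typed leaf); Balaban1985BackgroundPropagators, Thm 3.3 p.398 (the leaf `b9`, bookkeeping); Balaban1989LargeFieldII, Thm 1 + (0.1) pp.355–356; Balaban1988Convergent, p.244 (the record, bookkeeping)]
-/

noncomputable section

namespace Summit.QuantumFields.YangMills.BalabanUVNodes.N05SlotVacuity

open Literature.MathematicalPhysics.QuantumFieldTheory.Balaban1983to89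
open Literature.MathematicalPhysics.QuantumFieldTheory.Balaban1983to89.Node00
open Literature.MathematicalPhysics.QuantumFieldTheory.Balaban1983to89.T4Continuum
open Literature.MathematicalPhysics.QuantumFieldTheory.Balaban1983to89.DagBinding
open Literature.MathematicalPhysics.QuantumFieldTheory.Balaban1983to89.B8LeafModelZd3SourceReality (not_b8LeafOfRecordSubB)
open AveragingRT T4FiniteEpsInhabited FlowStep FlowStepRuns T4DatumAssembly
open scoped Matrix.Norms.L2Operator

variable {F : T4Family} {N : ℕ} [NeZero N] {D : FiniteEpsData F (SU N)} {w : WorldP}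

/-- **An admissible Stage-13 tuple has lattice dimension `D ≥ 2`** — the first clause of `Node00.Stage1Params.Admissible` («`2 ≤ θ.D`»), read through the
admissibility chain Stage 13 → 9 → 8 → 7 → 5 → 1. [cite: Balaban1983RegularityDecay, (1.6) p.572 (hypothesis dictionary, bookkeeping)] -/
theorem two_le_D_of_admissible₁₃ {θ : Stage13Params F N} (h : θ.Admissible F N) : 2 ≤ θ.toStage3Params.D :=
  (h.toStage9.toStage8).1.1.1.1

/-- ★ **THE `b8` LEAF IS FALSE AT EVERY STAGE-13 [B8″]-PINNED RECORD**: for every `F`, `N`, datum `D`, world `w` with `IsRecordOfRecord₁₃CSB8subB F N D w` and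
every package `P`, `¬ (leavesP w P).b8` — the record's `b8` IS `B8LeafOfRecordSubB θ λ` (`leaf_b8_iff_of_isRecordOfRecord₁₃CSB8subB`), uninhabited for every
`λ` at `θ.D ≥ 2` (`B8LeafModelZd3SourceReality.not_b8LeafOfRecordSubB`; `2 ≤ D` by admissibility).
[cite: Balaban1985RegularSpaces, Thm 8 (1.146) p.101 («Lie algebra valued»), Lemma 1 – Thm 8 pp.79–101 (the typed leaf); Balaban1989LargeFieldII, Thm 1 + (0.1) pp.355–356 (the record, bookkeeping)] -/
theorem not_b8_of_isRecordOfRecord₁₃CSB8subB (h : IsRecordOfRecord₁₃CSB8subB F N D w) (P : B12.RunParams) : ¬ (leavesP w P).b8 := by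
  obtain ⟨θ, lam, hθ, -, hiff⟩ := leaf_b8_iff_of_isRecordOfRecord₁₃CSB8subB h
  exact fun hb => not_b8LeafOfRecordSubB θ.toStage3Params (two_le_D_of_admissible₁₃ hθ) lam ((hiff P).1 hb)

/-- ★ **N05 AT SUCH A RECORD ⟺ THE [4] LEAF FAILS**: `Dag.B8_main (leavesP w P) ↔ ¬ (leavesP w P).b9` — the in-edges `b5 b6 b7` are theorems at the record
(`b8_b11_b10_main_iff_of_isRecordOfRecord₁₃CSB8subB`: `B8_main ↔ (b9 → b8)`) and `b8` is false; so the node «holds» there only ex falso.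
[cite: Balaban1985RegularSpaces, Lemma 1 – Thm 8 pp.79–101; Balaban1985BackgroundPropagators, Thm 3.3 p.398 (bookkeeping: the leaf `b9`)] -/
theorem b8_main_iff_not_b9_of_isRecordOfRecord₁₃CSB8subB (h : IsRecordOfRecord₁₃CSB8subB F N D w) (P : B12.RunParams) :
    Dag.B8_main (leavesP w P) ↔ ¬ (leavesP w P).b9 := by
  obtain ⟨h8, -, -⟩ := b8_b11_b10_main_iff_of_isRecordOfRecord₁₃CSB8subB h P
  rw [h8]
  exact ⟨fun h98 h9 => not_b8_of_isRecordOfRecord₁₃CSB8subB h P (h98 h9), fun hn9 h9 => absurd h9 hn9⟩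

/-- **No world of the [B8″]-pinned Stage-13 record has `b8` at any package** — so every ∃-currency N05 face of the shape
`∃ w, IsRecordOfRecord₁₃CSB8subB F N D w ∧ … ∧ (∃∕∀ P, (leavesP w P).b8 …)` has jointly unsatisfiable hypotheses as typed.
[cite: Balaban1985RegularSpaces, Thm 8 (1.146) p.101; Balaban1989LargeFieldII, Thm 1 + (0.1) pp.355–356 (bookkeeping)] -/
theorem not_exists_isRecordOfRecord₁₃CSB8subB_and_b8 (D : FiniteEpsData F (SU N)) :
    ¬ ∃ w : WorldP, IsRecordOfRecord₁₃CSB8subB F N D w ∧ ∃ P : B12.RunParams, (leavesP w P).b8 := by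
  rintro ⟨w, hw, P, hb⟩
  exact not_b8_of_isRecordOfRecord₁₃CSB8subB hw P hb

end Summit.QuantumFields.YangMills.BalabanUVNodes.N05SlotVacuity

end
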